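import Literature.NumberTheory.LFunctions.WeightedDiscreteMeanValue
import HarnessLib

/-!
# Proposition 5.4 (Conrey–Iwaniec 2002) with point-dependent weights, for absolutely convergent
# Dirichlet series

B. Conrey, H. Iwaniec, *Spacing of zeros of Hecke L-functions and the class number problem*,
Acta Arith. 103 (2002), §5 Proposition 5.4 (5.19) [held text `paper:arxiv-math_0111012`, p0014].

The tree's `WeightedMeanValue.weighted_discreteMeanValue_integral` (Proposition 5.4 with
point-dependent weights) is stated for finite Dirichlet polynomials `Σ_{n ≤ N}`. In §8 the sum
`A_{13}(s) = Σ_n λ(n) n^{−s} w_s(n) V_s(n/Q)` ranges over ALL `n ≫ T` (an absolutely convergent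
series), and the main term is fed to Proposition 6.4, an integral of the full `L`-series. This file
passes to the limit `N → ∞`:

* `weighted_discreteMeanValue_integral_tsum`: for coefficients with `a₀ = 0`, `Σ ‖a_n‖ < ∞`,
  `Σ (1 + n/T)‖a_n‖² < ∞`, `δ`-separated points `𝒯 ⊂ [T, 2T]` (`T ≥ 2`) and admissible, uniformly
  bounded weights `ω_t` with `‖ω_t‖₂² + ‖ω_t′‖₂² ≤ c`:
  `Σ_t |Σ_n a_n ω_t(log n) n^{−it}|² ≤ 180·c·δ⁻¹·(∫_{T/2}^{3T} |Σ_n a_n n^{−iτ}|² dτ + Σ_n (1+n/T)|a_n|²)`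
  (partial sums → series; dominated convergence on `[T/2, 3T]` with the constant majorant
  `(Σ‖a_n‖)²`).

Everything PROVED; no definition.

«The programme SEARCHES and TYPES; no claim about Landau–Siegel zeros until a kernel theorem says so.»

## References
* [ConreyIwaniec2002] B. Conrey, H. Iwaniec, Acta Arith. 103 (2002) 259–312, arXiv:math/0111012:
  §5 Proposition 5.4 (5.18)–(5.19); §8 (8.5)–(8.7).
-/

noncomputable section

open Complex MeasureTheory Filter Set Finset Real
open scoped Topology

namespace Literature.NumberTheory.LFunctions

namespace WeightedMeanValue

open Gallagher (phase norm_phase continuous_phase natCast_cpow_eq_phase)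

/-- `‖n^{−iτ}‖ ≤ 1` for all `n : ℕ` (it is `1` for `n ≥ 1` and `0^{−iτ} ∈ {0, 1}`).
[cite: ConreyIwaniec2002, §5 (5.1)] -/
theorem norm_natCast_cpow_neg_mul_I_le (n : ℕ) (τ : ℝ) : ‖(n : ℂ) ^ (-((τ : ℂ) * I))‖ ≤ 1 := by
  rcases Nat.eq_zero_or_pos n with rfl | hn
  · rw [Nat.cast_zero]
    by_cases h : (-((τ : ℂ) * I)) = 0
    · rw [h, Complex.cpow_zero, norm_one]
    · rw [Complex.zero_cpow h, norm_zero]; exact zero_le_one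
  · rw [natCast_cpow_eq_phase (by omega), norm_phase]

/-- Partial sums over `Finset.range M` equal partial sums over `Finset.Icc 1 (M − 1)` when the
`0`-th term vanishes. [cite: ConreyIwaniec2002, §5 (5.1)] -/
theorem sum_range_eq_sum_Icc_of_zero {f : ℕ → ℂ} (h0 : f 0 = 0) (M : ℕ) :
    ∑ n ∈ Finset.range M, f n = ∑ n ∈ Finset.Icc 1 (M - 1), f n := by
  symm
  refine Finset.sum_subset (fun n hn => ?_) (fun n hn hn' => ?_)
  · simp only [Finset.mem_Icc] at hn; simp only [Finset.mem_range]; omega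
  · simp only [Finset.mem_range] at hn
    simp only [Finset.mem_Icc, not_and_or, not_le] at hn'
    have : n = 0 := by omega
    rw [this, h0]

/-- The real counterpart of `sum_range_eq_sum_Icc_of_zero`. [cite: ConreyIwaniec2002, §5 (5.1)] -/
theorem sum_range_eq_sum_Icc_of_zero_real {f : ℕ → ℝ} (h0 : f 0 = 0) (M : ℕ) :
    ∑ n ∈ Finset.range M, f n = ∑ n ∈ Finset.Icc 1 (M - 1), f n := by
  symm
  refine Finset.sum_subset (fun n hn => ?_) (fun n hn hn' => ?_)
  · simp only [Finset.mem_Icc] at hn; simp only [Finset.mem_range]; omega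
  · simp only [Finset.mem_range] at hn
    simp only [Finset.mem_Icc, not_and_or, not_le] at hn'
    have : n = 0 := by omega
    rw [this, h0]

/-- **Proposition 5.4 with point-dependent weights, for absolutely convergent Dirichlet series.**
Let `a : ℕ → ℂ` with `a₀ = 0`, `Σ ‖a_n‖ < ∞` and `Σ (1 + n/T)‖a_n‖² < ∞`; let `𝒯 ⊂ [T, 2T]`
(`T ≥ 2`) be `δ`-separated (`0 < δ ≤ 1`), and for `t ∈ 𝒯` let `ω_t ∈ C¹(ℝ)` with
`ω_t, ω_t′ ∈ L¹ ∩ L²`, `‖ω_t‖₂² + ‖ω_t′‖₂² ≤ c` and `‖ω_t‖_∞ ≤ B`. Then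
`Σ_t |Σ_n a_n ω_t(log n) n^{−it}|² ≤ 180·c·δ⁻¹·(∫_{T/2}^{3T} |Σ_n a_n n^{−iτ}|² dτ + Σ_n (1+n/T)|a_n|²)`.
[cite: ConreyIwaniec2002, Proposition 5.4 (5.19)] -/
theorem weighted_discreteMeanValue_integral_tsum (a : ℕ → ℂ) {T δ c B : ℝ} (𝒯 : Finset ℝ)
    (ω : ℝ → ℝ → ℂ) (hT : 2 ≤ T) (hδ : 0 < δ) (hδ1 : δ ≤ 1) (hc : 0 ≤ c)
    (ha0 : a 0 = 0) (ha1 : Summable fun n => ‖a n‖)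
    (ha2 : Summable fun n => (1 + n / T) * ‖a n‖ ^ 2)
    (hmem : ∀ t ∈ 𝒯, T ≤ t ∧ t ≤ 2 * T) (hsep : ∀ t ∈ 𝒯, ∀ t' ∈ 𝒯, t ≠ t' → δ ≤ |t - t'|)
    (hω : ∀ t ∈ 𝒯, Differentiable ℝ (ω t) ∧ Integrable (ω t) ∧ Integrable (deriv (ω t)) ∧
      MemLp (ω t) 2 ∧ MemLp (deriv (ω t)) 2 ∧
      (∫ y : ℝ, ‖ω t y‖ ^ 2) + (∫ y : ℝ, ‖deriv (ω t) y‖ ^ 2) ≤ c)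
    (hωB : ∀ t ∈ 𝒯, ∀ y, ‖ω t y‖ ≤ B) :
    ∑ t ∈ 𝒯, ‖∑' n : ℕ, a n * ω t (Real.log n) * (n : ℂ) ^ (-((t : ℂ) * I))‖ ^ 2 ≤
      180 * c * δ⁻¹ *
        ((∫ τ in (T / 2)..(3 * T), ‖∑' n : ℕ, a n * (n : ℂ) ^ (-((τ : ℂ) * I))‖ ^ 2) +
          ∑' n : ℕ, (1 + n / T) * ‖a n‖ ^ 2) := by
  have hT0 : 0 < T := by linarith
  -- notation
  set A : ℝ := ∑' n : ℕ, ‖a n‖ with hA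
  have hA0 : 0 ≤ A := tsum_nonneg fun n => norm_nonneg _
  set f : ℝ → ℕ → ℂ := fun t n => a n * ω t (Real.log n) * (n : ℂ) ^ (-((t : ℂ) * I)) with hf
  set g : ℝ → ℕ → ℂ := fun τ n => a n * (n : ℂ) ^ (-((τ : ℂ) * I)) with hg
  set e : ℕ → ℝ := fun n => (1 + n / T) * ‖a n‖ ^ 2 with he
  -- summability of the pointwise series
  have hB' : ∀ t ∈ 𝒯, 0 ≤ B := fun t ht => (norm_nonneg _).trans (hωB t ht 0)
  have hf_norm : ∀ t ∈ 𝒯, ∀ n, ‖f t n‖ ≤ B * ‖a n‖ := by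
    intro t ht n
    simp only [hf, norm_mul]
    calc ‖a n‖ * ‖ω t (Real.log n)‖ * ‖(n : ℂ) ^ (-((t : ℂ) * I))‖ ≤ ‖a n‖ * B * 1 := by
          gcongr
          · exact mul_nonneg (norm_nonneg _) (hB' t ht)
          · exact hωB t ht _
          · exact norm_natCast_cpow_neg_mul_I_le n t
      _ = B * ‖a n‖ := by ring
  have hf_sum : ∀ t ∈ 𝒯, Summable (f t) := fun t ht =>
    Summable.of_norm_bounded (ha1.mul_left B) (hf_norm t ht)
  have hg_norm : ∀ τ n, ‖g τ n‖ ≤ ‖a n‖ := by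
    intro τ n
    simp only [hg, norm_mul]
    calc ‖a n‖ * ‖(n : ℂ) ^ (-((τ : ℂ) * I))‖ ≤ ‖a n‖ * 1 :=
          mul_le_mul_of_nonneg_left (norm_natCast_cpow_neg_mul_I_le n τ) (norm_nonneg _)
      _ = ‖a n‖ := mul_one _
  have hg_sum : ∀ τ, Summable (g τ) := fun τ => Summable.of_norm_bounded ha1 (hg_norm τ)
  have hf0 : ∀ t, f t 0 = 0 := fun t => by simp [hf, ha0]
  have hg0 : ∀ τ, g τ 0 = 0 := fun τ => by simp [hg, ha0]
  have he0 : e 0 = 0 := by simp [he, ha0]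
  -- Proposition 5.4′ for the partial sums over `range M` (= `Icc 1 (M-1)`)
  have hfin : ∀ M : ℕ,
      ∑ t ∈ 𝒯, ‖∑ n ∈ Finset.range M, f t n‖ ^ 2 ≤
        180 * c * δ⁻¹ * ((∫ τ in (T / 2)..(3 * T), ‖∑ n ∈ Finset.range M, g τ n‖ ^ 2) +
          ∑ n ∈ Finset.range M, e n) := by
    intro M
    have h := weighted_discreteMeanValue_integral (M - 1) a 𝒯 ω hT hδ hδ1 hc hmem hsep hω
    have e1 : ∀ t, ∑ n ∈ Finset.range M, f t n = ∑ n ∈ Finset.Icc 1 (M - 1), f t n :=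
      fun t => sum_range_eq_sum_Icc_of_zero (hf0 t) M
    have e2 : ∀ τ, ∑ n ∈ Finset.range M, g τ n = ∑ n ∈ Finset.Icc 1 (M - 1), g τ n :=
      fun τ => sum_range_eq_sum_Icc_of_zero (hg0 τ) M
    have e3 : ∑ n ∈ Finset.range M, e n = ∑ n ∈ Finset.Icc 1 (M - 1), e n :=
      sum_range_eq_sum_Icc_of_zero_real he0 M
    simp_rw [e1, e2, e3]
    exact h
  -- limits as `M → ∞`: the left side
  have hL : Tendsto (fun M => ∑ t ∈ 𝒯, ‖∑ n ∈ Finset.range M, f t n‖ ^ 2) atTop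
      (𝓝 (∑ t ∈ 𝒯, ‖∑' n, f t n‖ ^ 2)) := by
    refine tendsto_finsetSum 𝒯 fun t ht => ?_
    exact (((hf_sum t ht).tendsto_sum_tsum_nat).norm).pow 2
  -- the error sum
  have hE : Tendsto (fun M => ∑ n ∈ Finset.range M, e n) atTop (𝓝 (∑' n, e n)) :=
    ha2.tendsto_sum_tsum_nat
  -- the integral, by dominated convergence with the constant majorant `A²`
  have hgc : ∀ n, Continuous fun τ : ℝ => g τ n := by
    intro n
    rcases Nat.eq_zero_or_pos n with rfl | hn
    · simp only [hg0]; exact continuous_const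
    · have : (fun τ : ℝ => g τ n) = fun τ => a n * phase n τ := by
        funext τ; simp only [hg]; rw [natCast_cpow_eq_phase (by omega)]
      rw [this]; exact continuous_const.mul (continuous_phase n)
  have hI : Tendsto (fun M => ∫ τ in (T / 2)..(3 * T), ‖∑ n ∈ Finset.range M, g τ n‖ ^ 2) atTop
      (𝓝 (∫ τ in (T / 2)..(3 * T), ‖∑' n, g τ n‖ ^ 2)) := by
    refine intervalIntegral.tendsto_integral_filter_of_dominated_convergence (fun _ => A ^ 2) ?_ ?_ ?_ ?_
    · exact Eventually.of_forall fun M =>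
        ((continuous_finsetSum _ fun n _ => hgc n).norm.pow 2).aestronglyMeasurable
    · refine Eventually.of_forall fun M => Eventually.of_forall fun τ _ => ?_
      rw [Real.norm_of_nonneg (by positivity)]
      have hle : ‖∑ n ∈ Finset.range M, g τ n‖ ≤ A := by
        calc ‖∑ n ∈ Finset.range M, g τ n‖ ≤ ∑ n ∈ Finset.range M, ‖g τ n‖ := norm_sum_le _ _
          _ ≤ ∑ n ∈ Finset.range M, ‖a n‖ := Finset.sum_le_sum fun n _ => hg_norm τ n
          _ ≤ A := ha1.sum_le_tsum _ (fun n _ => norm_nonneg _)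
      exact pow_le_pow_left₀ (norm_nonneg _) hle 2
    · exact intervalIntegrable_const
    · refine Eventually.of_forall fun τ _ => ?_
      exact (((hg_sum τ).tendsto_sum_tsum_nat).norm).pow 2
  have hR : Tendsto (fun M => 180 * c * δ⁻¹ *
      ((∫ τ in (T / 2)..(3 * T), ‖∑ n ∈ Finset.range M, g τ n‖ ^ 2) + ∑ n ∈ Finset.range M, e n))
      atTop (𝓝 (180 * c * δ⁻¹ * ((∫ τ in (T / 2)..(3 * T), ‖∑' n, g τ n‖ ^ 2) + ∑' n, e n))) :=
    (hI.add hE).const_mul _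
  exact le_of_tendsto_of_tendsto' hL hR hfin

end WeightedMeanValue

end Literature.NumberTheory.LFunctions

end
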